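import Summits.BirchSwinnertonDyer.BirchSwinnertonDyer.Theorems.AlignedTransportAtTwoMainConjectureOfRankZeroBSDAtTwoFineRoadKleinCountingS3
import HarnessLib

/-!
# Route `AlignedTransportAtTwo`, crux C2 `MainConjectureOfRankZeroBSDAtTwo` (stmt-BirchSwinnertonDyer-22298),
# road (b″): PERFECT DESCENT at `2`, part VIII — the EXACT counting lemma for `Q̄ = S₃`:
# `#Hom_{S₃}(V, V₄)² = #((1 − e₁)V)`, i.e. `dim_{𝔽₂} Hom_{S₃}(V, V₄) = ½ · dim_{𝔽₂}((1 − e₁)V)`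

Cell `bsd-f1-sign2`, WIDTH-5 attach seat `bsd-line-att-p3` (gen 4) on line `birth` of crux C2
(`--supports` stmt-BirchSwinnertonDyer-22298; closes nothing). HONEST FRAMING: THEOREMS ONLY — no definition, no
named fact, no instance, no `sorry`; BSD is NOT proved by any of this. Sequel of `…FineRoadKleinCountingS3` (the two-
sided bounds): the lead's FREE target (c1), PERFECT-DESCENT.md §3 (iii), now with the EXACT value stated in the note,
«`dim_{𝔽₂} Hom_{S₃}(V, N) = [V : N] = ½ · dim_{𝔽₂}((1 − e₁)V)`». Setting as in parts VI–VII.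

## What is proved

* **`natCard_sigmaEquivariant_eq_sq`**: `#Hom_σ(V, M) = #Hom_{σ,τ}(V, M)²`. The averaging operator
  `T f = f + τ f τ : Hom_σ → Hom_{σ,τ}` of part VII is ONTO — for `h ∈ Hom_{σ,τ}` the `σ`-equivariant map `σ ∘ h`
  has `T(σ h) = σ h + τ σ τ h = (σ + σ²) h = h` (`τστ = σ²`, `σ + σ² = 1` on `M`; the additive Hilbert 90 for the
  Frobenius-semilinear involution `f ↦ τ f τ` on the `𝔽₄`-space `Hom_σ`) — and its kernel is EXACTLY `Hom_{σ,τ}`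
  (`τ h τ = h ⟹ T h = 2h = 0`, and conversely); so `#Hom_σ = #im T · #ker T = #Hom_{σ,τ}²`.
* **`natCard_equivariant_S3_eq`**: for `Q̄ = S₃` (a fixed-point-free `σ` and a non-trivial `τ` with a fixed point)
  and a finite `2`-torsion `Q`-module `V` on which the kernel of the action acts trivially,
  `#{w ∈ V | w + σ w + σ² w = 0} = #Hom_Q(V, M)²` — with part VI (`#Hom_σ = #((1 − e₁)V)`) and
  `equivariant_iff_sigma_tau` of part VII. Together with part VI's `C₃`-case this is the counting lemma of §3 (iii)
  of the note for both possible images `G_∞ ∈ {C₃, S₃}`.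

References: J.-P. Serre, *Linear Representations of Finite Groups*, §2.6; *Local Fields* X §1 (additive Hilbert 90);
PERFECT-DESCENT.md §3 (iii) (lead att-p2 g4).
-/

set_option autoImplicit false
-- the Theorems namespace of this sub repeats the summit name by design (D-0017 nested layout)
set_option linter.dupNamespace false

namespace Summit.BirchSwinnertonDyer.BirchSwinnertonDyer.Theorems.AlignedTransportAtTwoFineRoad.PerfectDescent

open Summit.BirchSwinnertonDyer.BirchSwinnertonDyer.Theorems.MultTransportAtTwo

variable {Q : Type*} [Group Q] {M : Type*} [AddCommGroup M] [DistribMulAction Q M]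
  {V : Type*} [AddCommGroup V] [DistribMulAction Q V]

/-- **`#Hom_σ(V, M) = #Hom_{σ,τ}(V, M)²`** (finite `V`): the averaging operator `T f = f + τ f τ` from the
`σ`-equivariant additive maps to the `σ,τ`-equivariant ones is SURJECTIVE (`T(σ ∘ h) = (σ + σ²) h = h`) with kernel
exactly the `σ,τ`-equivariant maps, so `#Hom_σ = #Hom_{σ,τ} · #Hom_{σ,τ}`. [cite: SerreGaloisCohomology1997, I §5.1] -/
theorem natCard_sigmaEquivariant_eq_sq [Finite V] (h4 : Nat.card M = 4) (h2 : ∀ m : M, m + m = 0) {σ τ : Q}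
    {m₀ : M} (hσ : ∀ m : M, σ • m = m → m = 0) (hm₀ : m₀ ≠ 0) (hτ0 : τ • m₀ = m₀) (hτ : ¬ ∀ m : M, τ • m = m)
    (hVN : ∀ g : Q, (∀ m : M, g • m = m) → ∀ v : V, g • v = v) :
    Nat.card {f : V →+ M // ∀ v : V, f (σ • v) = σ • f v} =
      Nat.card {f : V →+ M // (∀ v : V, f (σ • v) = σ • f v) ∧ ∀ v : V, f (τ • v) = τ • f v} ^ 2 := by
  classical
  haveI : Finite M := Nat.finite_of_card_ne_zero (by rw [h4]; norm_num)
  haveI : Finite (V →+ M) := Finite.of_injective (fun f : V →+ M ↦ (f : V → M)) DFunLike.coe_injective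
  have hττ := tau_tau h4 h2 hσ hm₀ hτ0 hτ
  have hτσ := tau_sigma h4 h2 hσ hm₀ hτ0 hτ
  have hτσσ := tau_sigma_sigma h4 h2 hσ hm₀ hτ0 hτ
  have hττV := tau_tau_V h4 h2 hσ hm₀ hτ0 hτ hVN
  have hτσV := tau_sigma_V h4 h2 hσ hm₀ hτ0 hτ hVN
  have hplusM : ∀ m : M, σ • m + σ • (σ • m) = m := fun m ↦ by
    rw [smul_smul_eq_add_of_fpf h4 h2 hσ, add_left_comm, h2, add_zero]
  -- the two subgroups of `V →+ M`
  let Lσ : AddSubgroup (V →+ M) :=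
    { carrier := {f | ∀ v : V, f (σ • v) = σ • f v}
      zero_mem' := fun v ↦ by rw [AddMonoidHom.zero_apply, AddMonoidHom.zero_apply, smul_zero]
      add_mem' := fun {f g} hf hg v ↦ by rw [AddMonoidHom.add_apply, AddMonoidHom.add_apply, hf, hg, smul_add]
      neg_mem' := fun {f} hf v ↦ by rw [AddMonoidHom.neg_apply, AddMonoidHom.neg_apply, hf, smul_neg] }
  let Lστ : AddSubgroup (V →+ M) :=
    { carrier := {f | (∀ v : V, f (σ • v) = σ • f v) ∧ ∀ v : V, f (τ • v) = τ • f v}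
      zero_mem' := ⟨fun v ↦ by rw [AddMonoidHom.zero_apply, AddMonoidHom.zero_apply, smul_zero],
        fun v ↦ by rw [AddMonoidHom.zero_apply, AddMonoidHom.zero_apply, smul_zero]⟩
      add_mem' := fun {f g} hf hg ↦ ⟨fun v ↦ by
          rw [AddMonoidHom.add_apply, AddMonoidHom.add_apply, hf.1, hg.1, smul_add],
        fun v ↦ by rw [AddMonoidHom.add_apply, AddMonoidHom.add_apply, hf.2, hg.2, smul_add]⟩
      neg_mem' := fun {f} hf ↦ ⟨fun v ↦ by rw [AddMonoidHom.neg_apply, AddMonoidHom.neg_apply, hf.1, smul_neg],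
        fun v ↦ by rw [AddMonoidHom.neg_apply, AddMonoidHom.neg_apply, hf.2, smul_neg]⟩ }
  have hLσ : ∀ f : V →+ M, f ∈ Lσ ↔ ∀ v : V, f (σ • v) = σ • f v := fun _ ↦ Iff.rfl
  have hLστ : ∀ f : V →+ M, f ∈ Lστ ↔ (∀ v : V, f (σ • v) = σ • f v) ∧ ∀ v : V, f (τ • v) = τ • f v :=
    fun _ ↦ Iff.rfl
  -- the conjugate `τ f τ` and the averaging operator `T`
  let c : (V →+ M) →+ (V →+ M) :=
    { toFun := fun f ↦ (DistribSMul.toAddMonoidHom M τ).comp (f.comp (DistribSMul.toAddMonoidHom V τ))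
      map_zero' := by ext v; simp
      map_add' := fun f g ↦ by ext v; simp [smul_add] }
  have hc : ∀ (f : V →+ M) (v : V), c f v = τ • f (τ • v) := fun _ _ ↦ rfl
  have hcσ : ∀ f : V →+ M, f ∈ Lσ → c f ∈ Lσ := fun f hf v ↦ by
    rw [hc, hc, hτσV, hf, hf, hτσσ]
  let T : Lσ →+ Lστ :=
    { toFun := fun f ↦ ⟨f.1 + c f.1, ⟨(hLσ _).mp (Lσ.add_mem f.2 (hcσ f.1 f.2)), fun v ↦ by
        rw [AddMonoidHom.add_apply, AddMonoidHom.add_apply, hc, hc, hττV, smul_add, hττ, add_comm]⟩⟩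
      map_zero' := Subtype.ext (by simp)
      map_add' := fun f g ↦ Subtype.ext (by
        simp only [AddSubgroup.coe_add, map_add]; abel) }
  have hT : ∀ f : Lσ, ((T f : Lστ) : V →+ M) = f.1 + c f.1 := fun _ ↦ rfl
  -- `ker T` is exactly the `σ,τ`-equivariant maps
  have hker : ∀ f : Lσ, f ∈ T.ker ↔ (f.1 : V →+ M) ∈ Lστ := by
    intro f
    rw [AddMonoidHom.mem_ker]
    constructor
    · intro hf
      have h0 : f.1 + c f.1 = 0 := by rw [← hT, hf]; rfl
      refine ⟨f.2, fun v ↦ ?_⟩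
      have hv := congrArg (fun g : V →+ M ↦ g (τ • v)) h0
      simp only [AddMonoidHom.add_apply, hc, hττV, AddMonoidHom.zero_apply] at hv
      rw [← klein_neg_eq h2 (τ • f.1 v)]
      exact eq_neg_of_add_eq_zero_left hv
    · intro hf
      apply Subtype.ext
      rw [hT]
      change f.1 + c f.1 = 0
      ext v
      rw [AddMonoidHom.add_apply, hc, hf.2, hττ, AddMonoidHom.zero_apply]
      exact h2 _
  -- `T` is onto: `T (σ ∘ h) = h`
  have hsurj : Function.Surjective T := by
    intro h
    have hh := (hLστ h.1).mp h.2
    let f : V →+ M := (DistribSMul.toAddMonoidHom M σ).comp h.1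
    have hf : ∀ v : V, f v = σ • h.1 v := fun _ ↦ rfl
    have hfσ : f ∈ Lσ := fun v ↦ by rw [hf, hf, hh.1]
    refine ⟨⟨f, hfσ⟩, Subtype.ext ?_⟩
    rw [hT]
    ext v
    change f v + c f v = h.1 v
    rw [hc, hf, hf, hh.2, hτσ, hττ, hplusM]
  -- counting
  let ι : T.ker → Lστ := fun f ↦ ⟨(f.1 : Lσ).1, (hker f.1).mp f.2⟩
  have hι : Function.Bijective ι := by
    refine ⟨fun f g hfg ↦ ?_, fun h ↦ ?_⟩
    · apply Subtype.ext; apply Subtype.ext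
      exact congrArg (fun x : Lστ ↦ (x : V →+ M)) hfg
    · have hh := (hLστ h.1).mp h.2
      exact ⟨⟨⟨h.1, hh.1⟩, (hker ⟨h.1, hh.1⟩).mpr h.2⟩, rfl⟩
  have e1 : Nat.card Lσ = Nat.card (Lσ ⧸ T.ker) * Nat.card T.ker :=
    AddSubgroup.card_eq_card_quotient_mul_card_addSubgroup T.ker
  have e2 : Nat.card (Lσ ⧸ T.ker) = Nat.card T.range :=
    Nat.card_congr (QuotientAddGroup.quotientKerEquivRange T).toEquiv
  have e3 : Nat.card T.range = Nat.card Lστ := by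
    rw [AddMonoidHom.range_eq_top.mpr hsurj, AddSubgroup.card_top]
  have e4 : Nat.card T.ker = Nat.card Lστ := Nat.card_congr (Equiv.ofBijective ι hι)
  have eσ : Nat.card {f : V →+ M // ∀ v : V, f (σ • v) = σ • f v} = Nat.card Lσ :=
    Nat.card_congr (Equiv.subtypeEquivRight fun f ↦ (hLσ f).symm)
  have eστ : Nat.card {f : V →+ M // (∀ v : V, f (σ • v) = σ • f v) ∧ ∀ v : V, f (τ • v) = τ • f v} =
      Nat.card Lστ := Nat.card_congr (Equiv.subtypeEquivRight fun f ↦ (hLστ f).symm)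
  rw [eσ, eστ, e1, e2, e3, e4, sq]

/-- **The counting lemma of PERFECT-DESCENT.md §3 (iii) for `G_∞ ≅ S₃`, EXACT form.** Let `Q` act on the Klein
four-group `M` with a fixed-point-free `σ` and a non-trivial `τ` fixing `m₀ ≠ 0` (`Q̄ = Aut(M) ≅ S₃`), and on a
finite additive group `V` with `v + v = 0` on which the kernel of the action on `M` acts trivially. Then
`#{w ∈ V | w + σ w + σ² w = 0} = #Hom_Q(V, M)²`: **`dim_{𝔽₂} Hom_{S₃}(V, V₄) = ½ · dim_{𝔽₂}((1 − e₁)V)`**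
(= the multiplicity `[V : V₄]` of the Steinberg module in `V`). [cite: SerreGaloisCohomology1997, I §5.1] -/
theorem natCard_equivariant_S3_eq [Finite V] (h4 : Nat.card M = 4) (h2 : ∀ m : M, m + m = 0) {σ τ : Q}
    {m₀ : M} (hσ : ∀ m : M, σ • m = m → m = 0) (hm₀ : m₀ ≠ 0) (hτ0 : τ • m₀ = m₀) (hτ : ¬ ∀ m : M, τ • m = m)
    (hVN : ∀ g : Q, (∀ m : M, g • m = m) → ∀ v : V, g • v = v) (hV2 : ∀ v : V, v + v = 0) :
    Nat.card {w : V // w + σ • w + σ • (σ • w) = 0} =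
      Nat.card {f : V →+ M // ∀ (g : Q) (v : V), f (g • v) = g • f v} ^ 2 := by
  have e : Nat.card {f : V →+ M // ∀ (g : Q) (v : V), f (g • v) = g • f v} =
      Nat.card {f : V →+ M // (∀ v : V, f (σ • v) = σ • f v) ∧ ∀ v : V, f (τ • v) = τ • f v} :=
    Nat.card_congr (Equiv.subtypeEquivRight fun f ↦ equivariant_iff_sigma_tau h4 h2 hσ hm₀ hτ0 hτ hVN f)
  rw [e, ← natCard_sigmaEquivariant_eq h4 h2 hσ hVN hV2]
  exact natCard_sigmaEquivariant_eq_sq h4 h2 hσ hm₀ hτ0 hτ hVN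

end Summit.BirchSwinnertonDyer.BirchSwinnertonDyer.Theorems.AlignedTransportAtTwoFineRoad.PerfectDescent
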